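import Literature.MathematicalPhysics.QuantumFieldTheory.BalabanImbrieJaffe1984to88.BIJ88Sect3ModelBridge
import Literature.MathematicalPhysics.QuantumFieldTheory.BalabanImbrieJaffe1984to88.BIJ88Sect4Statements
import Literature.MathematicalPhysics.QuantumFieldTheory.BalabanImbrieJaffe1984to88.BIJ88Sect2Statements

/-!
# `BalabanImbrieJaffe1984to88.BIJ88Sect3Rescaling` — T. Bałaban, J. Imbrie, A. Jaffe, *Effective action and cluster properties of
the abelian Higgs model*, Commun. Math. Phys. **114** (1988) 257–315 [BalabanImbrieJaffe1988], p. 266: the rescaling of the action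
(3.3) from `T_ε` to the unit lattice `T₁` — displays **(3.6)**, **(3.7)** with the constants **(3.8)**–**(3.10)** — onto the model
(1.1)–(1.2) of T. Bałaban, J. Imbrie, A. Jaffe, *Renormalization of the Higgs model: minimizers, propagators and the stability of mean
field theory*, Commun. Math. Phys. **97** (1985) 299–329 [BalabanImbrieJaffe1985] (the general-`ε` companion of r18's unit-lattice
dictionary `BIJ88Sect3ModelBridge`; rulings G.5-1 / G.5-23 of the lit-balaban cell).

statement-level skeleton of published theorems with citation tags; proofs where landed; nothing here is a claim about the Yang–Mills mass gap

PDF held: `paper:balaban1988-cmp114-bij-abelian-higgs-effective-action` (journal page = PDF page + 256); renders of p. 265 [PDF 9] and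
p. 266 [PDF 10] read as images (`run/sessions/literature-prover-lit-balaban-p34-0/folder/pages/original-p009-x2.png`,
`HOME/lit-balaban-r15/pages/1988-cmp114-bij-abelian-higgs-effective-action-p010-x2.png`); C1 (1.1)–(1.2) p. 300 as typed in
`BIJ85Sect1Model`.

CITATION HEADER (lean-in-tree rule).  Part of the lit-balaban TYPED SKELETON (HOME `run/shared/lean/pub/lit-balaban/`), PHASE-2 proof
seat p34 (unit `lit-balaban-p34`; PHASE2-TARGETS.md §G.3 line p34 as RE-POINTED by rulings G.5-13/G.5-23: *"a NEW `BIJ88Sect3Rescaling.lean`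
(general-ε (3.3)↔(1.1) + (3.6)/(3.7)/(3.10)) importing r18 `BIJ88Sect3ModelBridge`"*).  WHAT IS REPRODUCED.  Rows `C2.Eq3.6`, `C2.Eq3.7`
(recorded `absent · rescaling bookkeeping` in ROWS-C2.md v1.1) together with (3.8)–(3.10), and the general-`ε` form of the bridge row
`C2.Eq3.3` ↦ `C1.Eq1.1`, ALL PROVED as identities between the objects ALREADY typed in `BIJ88Sect3Statements` (C2 (3.1), (3.3)–(3.4),
(3.10)), `BIJ88Sect2Statements` ((2.2) `eK`, `lamK`), `BIJ88Sect4Statements` ((3.8) = (4.14) `Pk`) and `BIJ85Sect1Model` (C1 (1.1)–(1.2)),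
REUSING r18's unit-lattice dictionary `BIJ88Sect3ModelBridge.{plaqVar_coe, covD_one_coe, higgsP_eq_selfInt, action_eq_BIJ85}` — nothing is
re-declared:
* §1 the group isomorphism `circleEquivU1 : Circle ≃* U1` between C1's gauge group (Mathlib's `Circle`) and C2's
  (`U1 = Matrix.unitaryGroup (Fin 1) ℂ`, read through `BIJ88Sect3Statements.toC`): `toC ∘ circleEquivU1 = (↑)`; it is, pointwise and by
  `rfl`, the map `z ↦ (z)` of the tree's `QuantumLattice.u1Rep` (the same function as `Balaban1983to89.T4CubeChartCircle.ofCircle`, which is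
  not imported here; that file's `map_ofCircle_haarProbability` identifies the Haar data should an integral over `Circle`-valued fields ever
  be needed — by ruling G.5-1/S2 everything that integrates stays on `GaugeField P j U1`);
* §2 the induced bijection of configuration spaces `fieldEquiv : BIJ85Sect1Model.U1Field P j ≃ GaugeField P j U1` with
  `cfg ∘ fieldEquiv = (↑)`, so that r18's `action_eq_BIJ85` reads on `actionU1` (the integrand of (3.1)) from either side;
* §3 the remaining pointwise dictionary: `covD c (↑u) φ = c • covDeriv u φ` for every `c = ε⁻¹` (r18: `c = 1`), and the gauge
  transformations C1 (2.7) ↔ C2 (`gaugeU`/`gaugePhi`, phases `h = e^{iλ}`);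
* §4 **the rescaling** `action_rescale_eq_BIJ85`: for every `ε > 0`, C2's (3.3) on `T_ε` (`w = ε^d`, `c = ε⁻¹`, `d = P.d`) evaluated at
  the rescaled scalar field `ε^{−(d−2)/2}φ` (p. 266: *"The scalar field is multiplied by ε^{−(d−2)/2}"*) IS C1's (1.1) with
  `e(ε) = eε^{(4−d)/2}`, `λ(ε) = λε^{4−d}`, mass term `(1 + 2δm²)ε²` and `E = E₀ + E₁ + |T₁|ε^d/(64λ)` — the exponent of (3.7) term by
  term: `e₀ = e(ε)` is (2.2) at `k = 0` (`eEps_eq_eK`), the scalar terms are `P₀(φ(x)) − ½δm²ε²|φ(x)|²` with `P₀` = (3.8) at `k = 0` and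
  `λ₀` = (3.9) (`selfInt_rescale_eq_Pk`; TRANSCRIPT NOTE T-p34-1 there and HOME/GAPS.md G-C2-01: (3.7)/(3.11)/(3.23) PRINT `+½δm²ε²|φ|²`,
  the sign opposite to what (3.4) `−½δm²|φ|²` gives — recorded, not repaired); at `ε = 1` this is r18's `action_eq_BIJ85`;
* §5 **(3.6)** `bracket_rescale`: the unnormalized expectation (3.1) of C2, `[F] = ∫𝒟u𝒟φ e^{−S^ε}F`, equals `∫𝒟u𝒟φ ρ₀(u, φ)` with the
  density (3.7) — the Jacobian `ε^{−(d−2)|T₁|}` of the field rescaling on `ℂ^{T₁}` (Mathlib `Measure.integral_comp_smul`, real dimension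
  `2|T₁|`) being EXACTLY the shift **(3.10)** `ℰ₀ = E₀ − (d−2)|T₁| log ε⁻¹` (`BIJ88Sect3Statements.calE0`), and *"Each factor φ in F acquires
  a factor ε^{−(d−2)/2}"* (p. 266) being the argument `ε^{−(d−2)/2}φ` of `F`.
Imports: Literature (r18's bridge → the two statement files; C2 Sects. 2 and 4 for `eK`/`lamK`/`Pk`) and Mathlib only.  No new `Prop`
facts; every declaration below is kernel-checked; standard axioms.
-/

namespace Literature.MathematicalPhysics.QuantumFieldTheory.BalabanImbrieJaffe1984to88.BIJ88Sect3Rescaling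

open Literature.MathematicalPhysics.QuantumFieldTheory.Balaban1983to89
open Literature.MathematicalPhysics.QuantumLattice (u1Rep u1Rep_apply u1Rep_mem_unitaryGroup)
open Literature.MathematicalPhysics.QuantumFieldTheory.BalabanImbrieJaffe1984to88.BIJ88Sect3Statements
open BIJ85Sect1Model (U1Field HiggsField plaq covDeriv selfInt eEps lamEps gaugeHiggs)
open BIJ88Sect3ModelBridge (plaqVar_coe covD_one_coe higgsP_eq_selfInt action_eq_BIJ85)
open scoped BigOperators ComplexConjugate
open _root_.MeasureTheory Complex

noncomputable section

/-! ## §1 The gauge group: `Circle ≃* U(1)` -/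

/-- The group isomorphism between the two realisations of the gauge group `U(1)` of the abelian Higgs model — C1 (1.1) p. 300
*"The gauge field u : bonds → U(1)"* typed over Mathlib's `Circle` (`BIJ85Sect1Model.U1Field`), C2 (1.1)/(3.3) typed over
`U1 = Matrix.unitaryGroup (Fin 1) ℂ` read through `toC` (`BIJ88Sect3Statements.cfg`): `z ↦ (z)` (the tree's `u1Rep z`, a unitary
`1 × 1` matrix by `u1Rep_mem_unitaryGroup`), inverse `g ↦ toC g = g₀₀` (on the circle by `norm_toC`). [cite: BalabanImbrieJaffe1988, (3.3) p.265] -/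
def circleEquivU1 : Circle ≃* U1 where
  toFun z := ⟨u1Rep z, u1Rep_mem_unitaryGroup z⟩
  invFun g := ⟨toC g, mem_sphere_zero_iff_norm.2 (norm_toC g)⟩
  left_inv z := Circle.ext (by simp [toC, Matrix.scalar_apply])
  right_inv g := by
    apply Subtype.ext
    ext i k
    obtain rfl : i = 0 := Subsingleton.elim _ _
    obtain rfl : k = 0 := Subsingleton.elim _ _
    simp [toC, Matrix.scalar_apply]
  map_mul' z w := Subtype.ext (map_mul u1Rep z w)

/-- kernel: the matrix of `circleEquivU1 z` is `u1Rep z = (z)` (so `circleEquivU1` agrees pointwise, by `rfl`, with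
`Balaban1983to89.T4CubeChartCircle.ofCircle`). [cite: BalabanImbrieJaffe1988, (3.3) p.265] -/
@[simp] theorem coe_circleEquivU1 (z : Circle) : ((circleEquivU1 z : U1) : Matrix (Fin 1) (Fin 1) ℂ) = u1Rep z := rfl

/-- kernel: `toC (circleEquivU1 z) = z` — C2's reading of a bond variable is C1's bond variable. [cite: BalabanImbrieJaffe1988, (3.3) p.265] -/
@[simp] theorem toC_circleEquivU1 (z : Circle) : toC (circleEquivU1 z) = z := by
  simp [circleEquivU1, toC, Matrix.scalar_apply]

/-- kernel: the inverse isomorphism is `toC` (as a point of the circle). [cite: BalabanImbrieJaffe1988, (3.3) p.265] -/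
@[simp] theorem coe_circleEquivU1_symm (g : U1) : ((circleEquivU1.symm g : Circle) : ℂ) = toC g := by
  conv_rhs => rw [← circleEquivU1.apply_symm_apply g]
  rw [toC_circleEquivU1]

/-- kernel: the tree's normalized real trace on `U(1)` is C1's `Re u` — `reTr (circleEquivU1 z) = Re z` (the Wilson terms
`1 − Re u(p)` of C1 (1.1) and C2 (3.3) are the tree's `1 − reTr`). [cite: BalabanImbrieJaffe1988, (3.3) p.265] -/
theorem reTr_circleEquivU1 (z : Circle) : GaugeGroup.reTr (circleEquivU1 z) = (z : ℂ).re := by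
  rw [reTr_eq, toC_circleEquivU1]

/-- kernel: `toC : U(1) → ℂ` is injective — a `1 × 1` unitary matrix is determined by its entry. [cite: BalabanImbrieJaffe1988, (3.3) p.265] -/
theorem toC_injective_U1 : Function.Injective (toC : U1 → ℂ) := fun g h hgh =>
  circleEquivU1.symm.injective (Circle.ext (by simpa using hgh))

variable {P : Params} {j : ℕ}

/-! ## §2 Configurations: `U1Field P j ≃ GaugeField P j U1` -/

/-- The induced bijection between C1's configurations `u : bonds → Circle` and C2's `U : GaugeField P j U1` (bondwise
`circleEquivU1`). [cite: BalabanImbrieJaffe1988, (3.3) p.265] -/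
def fieldEquiv : U1Field P j ≃ GaugeField P j U1 := Equiv.piCongrRight fun _ => circleEquivU1.toEquiv

/-- kernel: `fieldEquiv u b = circleEquivU1 (u b)`. [cite: BalabanImbrieJaffe1988, (3.3) p.265] -/
@[simp] theorem fieldEquiv_apply (u : U1Field P j) (b : PBond P j) : fieldEquiv u b = circleEquivU1 (u b) := rfl

/-- kernel: `fieldEquiv⁻¹ U b = circleEquivU1⁻¹ (U b)`. [cite: BalabanImbrieJaffe1988, (3.3) p.265] -/
@[simp] theorem fieldEquiv_symm_apply (U : GaugeField P j U1) (b : PBond P j) :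
    fieldEquiv.symm U b = circleEquivU1.symm (U b) := rfl

/-- kernel: C2's ℂ-valued reading `cfg` of the transported configuration is C1's, `cfg (fieldEquiv u) = ↑u`. [cite: BalabanImbrieJaffe1988, (3.3) p.265] -/
theorem cfg_fieldEquiv (u : U1Field P j) : cfg (fieldEquiv u) = fun b => (u b : ℂ) := by
  funext b
  simp [cfg]

/-- kernel: conversely `↑(fieldEquiv⁻¹ U) = cfg U`. [cite: BalabanImbrieJaffe1988, (3.3) p.265] -/
theorem coe_fieldEquiv_symm (U : GaugeField P j U1) : (fun b => ((fieldEquiv.symm U b : Circle) : ℂ)) = cfg U := by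
  funext b
  simp [cfg]

/-! ## §3 The pointwise dictionary beyond r18's (`plaqVar_coe`, `covD_one_coe`, `higgsP_eq_selfInt`): general `c`, gauge transformations -/

/-- C2's covariant derivative `(D^ε_u φ)(b) = ε⁻¹(u(b)φ(b₊) − φ(b₋))` (at `c = ε⁻¹`) is `c` times C1's `(D_uφ)_b = u_bφ_{b₊} − φ_{b₋}`
of (1.1) (r18's `covD_one_coe` is the case `c = 1`). [cite: BalabanImbrieJaffe1988, (3.3) p.265] -/
theorem covD_coe (c : ℝ) (u : U1Field P j) (φ : HiggsField P j) (b : PBond P j) :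
    covD c (fun b => (u b : ℂ)) φ b = (c : ℂ) * covDeriv u φ b := by
  rw [← covD_one_coe u φ b]
  simp only [covD, Complex.ofReal_one, one_mul]

/-- C1's gauge transformation (2.7) `u_b → h(b₋)h(b₊)⁻¹u_b` by `h = e^{iλ} : sites → U(1)` IS, read in `ℂ`, C2's
`u(b) ↦ e^{iλ(b₋)}u(b)e^{−iλ(b₊)}` (`BIJ88Sect3Statements.gaugeU`). [cite: BalabanImbrieJaffe1988, (4.16) p.276] -/
theorem gaugeU_coe (lam : Balaban1983to89.Site P j → ℝ) (u : U1Field P j) :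
    (fun b => ((BIJ85Sect1Model.gaugeU (fun x => Circle.exp (lam x)) u b : Circle) : ℂ)) =
      BIJ88Sect3Statements.gaugeU lam (fun b => (u b : ℂ)) := by
  funext b
  simp only [BIJ85Sect1Model.gaugeU, BIJ88Sect3Statements.gaugeU, Circle.coe_mul, Circle.coe_inv, Circle.coe_exp,
    ← Complex.exp_neg]
  ring

/-- C1's `φ_y → h(y)φ_y` (2.7) by `h = e^{iλ}` IS C2's `φ(x) ↦ e^{iλ(x)}φ(x)` (`BIJ88Sect3Statements.gaugePhi`, (4.16)).
[cite: BalabanImbrieJaffe1988, (4.16) p.276] -/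
theorem gaugeHiggs_coe (lam : Balaban1983to89.Site P j → ℝ) (φ : HiggsField P j) :
    gaugeHiggs (fun x => Circle.exp (lam x)) φ = gaugePhi lam φ := by
  funext x
  simp only [gaugeHiggs, gaugePhi, Circle.coe_exp]

/-! ## §4 The bridge C2 (3.3) ↦ C1 (1.1): r18's `ε = 1` dictionary through `fieldEquiv`, then every `ε > 0` -/

/-- kernel: C1's action (1.1) is affine in its constant `E`. [cite: BalabanImbrieJaffe1985, (1.1) p.300] -/
theorem action_add_const (eε lamε μsq E t : ℝ) (u : U1Field P j) (φ : HiggsField P j) :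
    BIJ85Sect1Model.action eε lamε μsq (E + t) u φ = BIJ85Sect1Model.action eε lamε μsq E u φ + t := by
  simp only [BIJ85Sect1Model.action]
  ring

/-- r18's unit-lattice bridge `BIJ88Sect3ModelBridge.action_eq_BIJ85` (row `C2.Eq3.3` ↔ `C1.Eq1.1` at `ε = 1`) read through
`fieldEquiv`: C2's `actionU1` (the integrand of (3.1)) at `w = c = 1` on the transported configuration is C1's action.
[cite: BalabanImbrieJaffe1988, (3.3) p.265] -/
theorem actionU1_fieldEquiv (e lam dm2 E₀ E₁ : ℝ) (u : U1Field P j) (φ : HiggsField P j) :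
    actionU1 1 1 e lam dm2 E₀ E₁ (fieldEquiv u) φ =
      BIJ85Sect1Model.action e lam (1 + 2 * dm2)
        (E₀ + E₁ + Fintype.card (Balaban1983to89.Site P j) * (1 / (64 * lam))) u φ := by
  rw [actionU1, cfg_fieldEquiv, action_eq_BIJ85]

/-- The same read from the C2 side: for every `U : GaugeField P j U1`, `actionU1` at `w = c = 1` is C1's action of `fieldEquiv⁻¹ U`.
[cite: BalabanImbrieJaffe1988, (3.3) p.265] -/
theorem actionU1_eq_BIJ85 (e lam dm2 E₀ E₁ : ℝ) (U : GaugeField P j U1) (φ : HiggsField P j) :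
    actionU1 1 1 e lam dm2 E₀ E₁ U φ =
      BIJ85Sect1Model.action e lam (1 + 2 * dm2)
        (E₀ + E₁ + Fintype.card (Balaban1983to89.Site P j) * (1 / (64 * lam))) (fieldEquiv.symm U) φ := by
  rw [actionU1, ← coe_fieldEquiv_symm, action_eq_BIJ85]

/-! ### The rescaling of p. 266: `T_ε ↦ T₁` -/

/-- p. 266 [PDF 10], verbatim: *"We rescale our expressions from T_ε to the unit lattice T₁. The scalar field is multiplied by
ε^{−(d−2)/2}"* — the scalar rescaling factor `ε^{−(d−2)/2} = ε^{(2−d)/2}`. [cite: BalabanImbrieJaffe1988, (3.6) p.266] -/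
def phiScale (ε : ℝ) (d : ℕ) : ℝ := ε ^ ((2 - (d : ℝ)) / 2)

/-- kernel: `ε^{−(d−2)/2} > 0` for `ε > 0`. [cite: BalabanImbrieJaffe1988, (3.6) p.266] -/
theorem phiScale_pos {ε : ℝ} (hε : 0 < ε) (d : ℕ) : 0 < phiScale ε d := Real.rpow_pos_of_pos hε _

/-- kernel: `(ε^{a/2})² = ε^a`. [cite: BalabanImbrieJaffe1988, (3.6) p.266] -/
private theorem rpow_half_sq {ε : ℝ} (hε : 0 < ε) (a : ℝ) : (ε ^ (a / 2)) ^ 2 = ε ^ a := by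
  rw [← Real.rpow_natCast, ← Real.rpow_mul hε.le]
  norm_num

/-- kernel: `ε^{n−d} = εⁿ/ε^d` (real exponent versus natural powers). [cite: BalabanImbrieJaffe1988, (3.6) p.266] -/
private theorem rpow_sub_nat {ε : ℝ} (hε : 0 < ε) (n d : ℕ) : ε ^ ((n : ℝ) - d) = ε ^ n / ε ^ d := by
  rw [Real.rpow_sub hε, Real.rpow_natCast, Real.rpow_natCast]

/-- kernel: `(ε^{−(d−2)/2})² = ε²/ε^d`. [cite: BalabanImbrieJaffe1988, (3.6) p.266] -/
theorem phiScale_sq {ε : ℝ} (hε : 0 < ε) (d : ℕ) : phiScale ε d ^ 2 = ε ^ 2 / ε ^ d := by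
  rw [phiScale, rpow_half_sq hε, show (2 : ℝ) - d = (2 : ℕ) - d by norm_num, rpow_sub_nat hε]

/-- kernel: `e(ε)⁻² = ε^d · ε⁻⁴/e²` — the Wilson weight `ε^d(e²ε⁴)⁻¹` of (3.3) is `e(ε)⁻²` of C1 (1.1), `e(ε) = eε^{(4−d)/2}`.
[cite: BalabanImbrieJaffe1988, (3.6) p.266] -/
theorem wilsonWeight_eq {ε : ℝ} (hε : 0 < ε) (e : ℝ) (d : ℕ) : ε ^ d * (ε⁻¹ ^ 4 / e ^ 2) = (eEps e ε d)⁻¹ ^ 2 := by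
  have hA : (ε ^ ((4 - (d : ℝ)) / 2)) ^ 2 = ε ^ 4 / ε ^ d := by
    rw [rpow_half_sq hε, show (4 : ℝ) - d = (4 : ℕ) - d by norm_num, rpow_sub_nat hε]
  have hεd : (ε ^ d : ℝ) ≠ 0 := pow_ne_zero _ hε.ne'
  have h4 : (ε ^ 4 : ℝ) ≠ 0 := pow_ne_zero _ hε.ne'
  set A := ε ^ ((4 - (d : ℝ)) / 2) with hA_def
  set w := (ε ^ d : ℝ) with hw
  rw [eEps, show (e * A)⁻¹ ^ 2 = (e ^ 2)⁻¹ * (A ^ 2)⁻¹ by ring, hA, inv_div,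
    show (ε⁻¹ : ℝ) ^ 4 = (ε ^ 4)⁻¹ by rw [inv_pow]]
  field_simp

/-- **The rescaling (3.6)–(3.10) of p. 266 as an identity of actions** (row `C2.Eq3.3` ↦ `C1.Eq1.1`): for every `ε > 0`, C2's action
(3.3) on `T_ε` — weights `w = ε^d`, `c = ε⁻¹` (`d = P.d`) — evaluated at the rescaled scalar field `ε^{−(d−2)/2}φ` IS C1's unit-lattice
action (1.1)–(1.2) of `(u, φ)` with `e(ε) = eε^{(4−d)/2}`, `λ(ε) = λε^{4−d}`, mass term `(1 + 2δm²)ε²` (`m² = 1`) and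
`E = E₀ + E₁ + |T₁|ε^d/(64λ)`: this is the exponent of (3.7) with `E₀` in place of `ℰ₀` (the Jacobian is accounted for in
`bracket_rescale`); at `ε = 1` it is r18's `BIJ88Sect3ModelBridge.action_eq_BIJ85`. [cite: BalabanImbrieJaffe1988, (3.7) p.266] -/
theorem action_rescale_eq_BIJ85 {ε : ℝ} (hε : 0 < ε) (e lam dm2 E₀ E₁ : ℝ) (u : U1Field P j) (φ : HiggsField P j) :
    action (ε ^ P.d) ε⁻¹ e lam dm2 E₀ E₁ (fun b => (u b : ℂ)) (phiScale ε P.d • φ) =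
      BIJ85Sect1Model.action (eEps e ε P.d) (lamEps lam ε P.d) ((1 + 2 * dm2) * ε ^ 2)
        (E₀ + E₁ + Fintype.card (Balaban1983to89.Site P j) * ε ^ P.d / (64 * lam)) u φ := by
  set s := phiScale ε P.d with hs_def
  have hs : 0 < s := phiScale_pos hε P.d
  have hs2 : s ^ 2 = ε ^ 2 / ε ^ P.d := phiScale_sq hε P.d
  have hB : ε ^ (4 - (P.d : ℝ)) = ε ^ 4 / ε ^ P.d := by
    rw [show (4 : ℝ) - P.d = (4 : ℕ) - P.d by norm_num, rpow_sub_nat hε]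
  have hεd : (ε ^ P.d : ℝ) ≠ 0 := pow_ne_zero _ hε.ne'
  have hε0 : ε ≠ 0 := hε.ne'
  -- (i) the Wilson term
  have h1 : ∀ p : Plaq P j, ε ^ P.d * (ε⁻¹ ^ 4 / e ^ 2) * (1 - (plaqVar (fun b => (u b : ℂ)) p).re) =
      (eEps e ε P.d)⁻¹ ^ 2 * (1 - ((plaq u p : Circle) : ℂ).re) := by
    intro p
    rw [plaqVar_coe, wilsonWeight_eq hε]
  -- (ii) the kinetic term
  have h2 : ∀ b : PBond P j, ε ^ P.d * ‖covD ε⁻¹ (fun b => (u b : ℂ)) (s • φ) b‖ ^ 2 = ‖covDeriv u φ b‖ ^ 2 := by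
    intro b
    have hcov : covD ε⁻¹ (fun b => (u b : ℂ)) (s • φ) b = ((ε⁻¹ * s : ℝ) : ℂ) * covDeriv u φ b := by
      simp only [covD, covDeriv, Pi.smul_apply, Complex.real_smul]
      push_cast
      ring
    have hfac : (ε⁻¹ * s) ^ 2 = (ε ^ P.d)⁻¹ := by
      rw [mul_pow, hs2]
      field_simp
    rw [hcov, norm_mul, Complex.norm_real, Real.norm_eq_abs, abs_of_pos (mul_pos (inv_pos.2 hε) hs), mul_pow, hfac]
    field_simp
  -- (iii) the scalar potential
  have h3 : ∀ x : Balaban1983to89.Site P j, ε ^ P.d * higgsP lam dm2 ((s • φ) x) =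
      selfInt (lamEps lam ε P.d) ((1 + 2 * dm2) * ε ^ 2) (φ x) + ε ^ P.d / (64 * lam) := by
    intro x
    rw [Pi.smul_apply, higgsP_eq_selfInt, selfInt, selfInt, lamEps, norm_smul, Real.norm_eq_abs, abs_of_pos hs, hB, mul_pow,
      mul_pow, show s ^ 4 = (s ^ 2) ^ 2 by ring, hs2]
    field_simp
  simp only [action, BIJ85Sect1Model.action, h1, h2, h3, Finset.sum_add_distrib, Finset.sum_const, Finset.card_univ,
    nsmul_eq_mul]
  ring

/-- The same rescaling through `fieldEquiv`, read from the C2 side (`actionU1`, the integrand of (3.1)).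
[cite: BalabanImbrieJaffe1988, (3.7) p.266] -/
theorem actionU1_rescale_eq_BIJ85 {ε : ℝ} (hε : 0 < ε) (e lam dm2 E₀ E₁ : ℝ) (U : GaugeField P j U1) (φ : HiggsField P j) :
    actionU1 (ε ^ P.d) ε⁻¹ e lam dm2 E₀ E₁ U (phiScale ε P.d • φ) =
      BIJ85Sect1Model.action (eEps e ε P.d) (lamEps lam ε P.d) ((1 + 2 * dm2) * ε ^ 2)
        (E₀ + E₁ + Fintype.card (Balaban1983to89.Site P j) * ε ^ P.d / (64 * lam)) (fieldEquiv.symm U) φ := by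
  rw [actionU1, ← coe_fieldEquiv_symm, action_rescale_eq_BIJ85 hε]

/-- The constants of (3.7) identified, I: C1's `e(ε) = eε^{(4−d)/2}` is C2's running charge (2.2) `e_k = (L^kε)^{(4−d)/2}e` at `k = 0`
(any `L`). [cite: BalabanImbrieJaffe1988, (2.2) p.260] -/
theorem eEps_eq_eK (L ε e : ℝ) (d : ℕ) : eEps e ε d = BIJ88Sect2Statements.eK L ε e d 0 := by
  simp only [eEps, BIJ88Sect2Statements.eK, pow_zero, one_mul]
  ring

/-- The constants of (3.7) identified, II: C1's `λ(ε) = λε^{4−d}` is **(3.9)** `λ_k = (L^kε)^{4−d}λ` at `k = 0`.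
[cite: BalabanImbrieJaffe1988, (3.9) p.266] -/
theorem lamEps_eq_lamK (L ε lam : ℝ) (d : ℕ) : lamEps lam ε d = BIJ88Sect2Statements.lamK L ε lam d 0 := by
  simp only [lamEps, BIJ88Sect2Statements.lamK, pow_zero, one_mul]
  ring

/-- The constants of (3.7) identified, III: the scalar terms of the rescaled action, site by site, are `P₀(φ(x))` of **(3.8)**
`P₀(φ) = λ₀|φ|⁴ − ¼ε²|φ|² + (1/64λ)ε^d` (`BIJ88Sect4Statements.Pk` at `k = 0`, `L^kε = ε`) with **(3.9)** `λ₀ = ε^{4−d}λ`, plus the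
mass counterterm `−½δm²ε²|φ(x)|²` — the sign being the one (3.4) `P(φ) = … − ½δm²|φ|²` PRODUCES under the rescaling.  TRANSCRIPT NOTE
(T-p34-1, reported to the C2 fold owner r18 and in HOME/GAPS.md): (3.7) — and likewise (3.11), (3.23) — PRINT this term as
`+½δm²ε²|φ(x)|²` in the action (display (3.7): `exp[− … − Σ_x ½δm²ε²|φ(x)|² − …]`), i.e. with the sign opposite to (3.4); the two printed
conventions differ by `δm² ↦ −δm²` (a counterterm of unspecified sign, `δm² = δm²(e, λ, ε)` p. 266).  Nothing is repaired silently: this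
identity is what (3.3)–(3.4) as typed give, and S3's `P0loc` keeps the `+` of the (3.23) display. [cite: BalabanImbrieJaffe1988, (3.8) p.266] -/
theorem selfInt_rescale_eq_Pk (L ε lam dm2 : ℝ) (d : ℕ) (z : ℂ) :
    selfInt (lamEps lam ε d) ((1 + 2 * dm2) * ε ^ 2) z + ε ^ d / (64 * lam) =
      BIJ88Sect4Statements.Pk (BIJ88Sect2Statements.lamK L ε lam d 0) ε lam d z - (1 / 2) * dm2 * ε ^ 2 * ‖z‖ ^ 2 := by
  simp only [selfInt, lamEps, BIJ88Sect4Statements.Pk, BIJ88Sect2Statements.lamK, pow_zero, one_mul]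
  ring

/-! ## §5 (3.6): the unnormalized expectation after rescaling, and the constant (3.10) -/

/-- kernel: the real dimension of the scalar-field space `ℂ^{T₁}` is `2|T₁|`. [cite: BalabanImbrieJaffe1988, (3.10) p.266] -/
theorem finrank_higgsField : Module.finrank ℝ (HiggsField P j) = 2 * Fintype.card (Balaban1983to89.Site P j) := by
  rw [Module.finrank_pi_fintype ℝ, Finset.sum_const, Complex.finrank_real_complex, smul_eq_mul, Finset.card_univ, mul_comm]

/-- kernel, **(3.10)** as the Jacobian: `log (ε^{−(d−2)/2})^{2|T₁|} = (d−2)|T₁| log ε⁻¹ = E₀ − ℰ₀` with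
`ℰ₀ = E₀ − (d−2)|T₁| log ε⁻¹` (`BIJ88Sect3Statements.calE0`). [cite: BalabanImbrieJaffe1988, (3.10) p.266] -/
theorem log_phiScale_pow {ε : ℝ} (hε : 0 < ε) (E₀ : ℝ) (d n : ℕ) :
    Real.log (phiScale ε d ^ (2 * n)) = E₀ - calE0 E₀ d n ε := by
  rw [Real.log_pow, phiScale, Real.log_rpow hε, calE0, Real.log_inv]
  push_cast
  ring

/-- kernel: the change of variables `φ ↦ s • φ` (`s > 0`) in `ℂ^{T₁}`, Jacobian `s^{2|T₁|}`, valid for EVERY integrand (Mathlib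
`Measure.integral_comp_smul`; both sides are the junk value together). [cite: BalabanImbrieJaffe1988, (3.6) p.266] -/
theorem integral_comp_smul_jac (G : HiggsField P j → ℂ) {s : ℝ} (hs : 0 < s) :
    ∫ φ, G φ = ∫ φ, (s ^ Module.finrank ℝ (HiggsField P j) : ℝ) • G (s • φ) := by
  have hn : (0 : ℝ) < s ^ Module.finrank ℝ (HiggsField P j) := pow_pos hs _
  rw [integral_smul, Measure.integral_comp_smul volume G s, abs_of_pos (inv_pos.2 hn), smul_smul, mul_inv_cancel₀ hn.ne',
    one_smul]

/-- kernel: a positive Jacobian `J` absorbed into the exponent, `J e^{−S} = e^{−T}` when `S = T + log J`. [cite: BalabanImbrieJaffe1988, (3.10) p.266] -/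
private theorem jac_mul_exp {J S T : ℝ} (hJ : 0 < J) (h : S = T + Real.log J) :
    J * Real.exp (-S) = Real.exp (-T) := by
  rw [h, neg_add, Real.exp_add, Real.exp_neg (Real.log J), Real.exp_log hJ]
  field_simp

/-- **(3.6)–(3.7) at a fixed gauge field** (the `𝒟φ` integral): for every `U : GaugeField P j U1` and every function `Φ` of the
`T_ε` scalar field, `∫𝒟φ e^{−S^ε(U, φ)} Φ(φ) = ∫𝒟φ exp[−S₁(U, φ)] Φ(ε^{−(d−2)/2}φ)` where `S₁` is C1's unit-lattice action (1.1) with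
`e(ε)`, `λ(ε)`, `(1 + 2δm²)ε²` and constant `ℰ₀ + E₁ + |T₁|ε^d/(64λ)`, `ℰ₀ = E₀ − (d−2)|T₁| log ε⁻¹` **(3.10)** — the exponent of
`ρ₀` in (3.7) (see `selfInt_rescale_eq_Pk` for the term-by-term reading and the sign note). [cite: BalabanImbrieJaffe1988, (3.7) p.266] -/
theorem integral_rescale {ε : ℝ} (hε : 0 < ε) (e lam dm2 E₀ E₁ : ℝ) (U : GaugeField P j U1) (Φ : HiggsField P j → ℂ) :
    ∫ φ : HiggsField P j, (Real.exp (-(actionU1 (ε ^ P.d) ε⁻¹ e lam dm2 E₀ E₁ U φ)) : ℂ) * Φ φ =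
      ∫ φ : HiggsField P j,
        (Real.exp (-(BIJ85Sect1Model.action (eEps e ε P.d) (lamEps lam ε P.d) ((1 + 2 * dm2) * ε ^ 2)
          (calE0 E₀ P.d (Fintype.card (Balaban1983to89.Site P j)) ε + E₁ +
            Fintype.card (Balaban1983to89.Site P j) * ε ^ P.d / (64 * lam)) (fieldEquiv.symm U) φ)) : ℂ) *
          Φ (phiScale ε P.d • φ) := by
  have hs : 0 < phiScale ε P.d := phiScale_pos hε P.d
  have hn : (0 : ℝ) < phiScale ε P.d ^ Module.finrank ℝ (HiggsField P j) := pow_pos hs _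
  -- the Jacobian `s ^ {2|T₁|} = ε^{−(d−2)|T₁|}` is the shift `E₀ ↦ ℰ₀` of (3.10)
  have hlog : Real.log (phiScale ε P.d ^ Module.finrank ℝ (HiggsField P j)) =
      E₀ - calE0 E₀ P.d (Fintype.card (Balaban1983to89.Site P j)) ε := by
    rw [finrank_higgsField, log_phiScale_pow hε]
  -- the exponent: C2's action at the rescaled field = C1's action with `ℰ₀`, plus the log-Jacobian
  have hS : ∀ φ : HiggsField P j, actionU1 (ε ^ P.d) ε⁻¹ e lam dm2 E₀ E₁ U (phiScale ε P.d • φ) =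
      BIJ85Sect1Model.action (eEps e ε P.d) (lamEps lam ε P.d) ((1 + 2 * dm2) * ε ^ 2)
        (calE0 E₀ P.d (Fintype.card (Balaban1983to89.Site P j)) ε + E₁ +
          Fintype.card (Balaban1983to89.Site P j) * ε ^ P.d / (64 * lam)) (fieldEquiv.symm U) φ +
        Real.log (phiScale ε P.d ^ Module.finrank ℝ (HiggsField P j)) := by
    intro φ
    have hsplit : E₀ + E₁ + Fintype.card (Balaban1983to89.Site P j) * ε ^ P.d / (64 * lam) =
        (calE0 E₀ P.d (Fintype.card (Balaban1983to89.Site P j)) ε + E₁ +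
          Fintype.card (Balaban1983to89.Site P j) * ε ^ P.d / (64 * lam)) +
        (E₀ - calE0 E₀ P.d (Fintype.card (Balaban1983to89.Site P j)) ε) := by ring
    rw [actionU1_rescale_eq_BIJ85 hε, hsplit, action_add_const, hlog]
  -- change of variables, then pointwise bookkeeping of the Jacobian
  have hcv := integral_comp_smul_jac (P := P) (j := j)
    (fun φ => (Real.exp (-(actionU1 (ε ^ P.d) ε⁻¹ e lam dm2 E₀ E₁ U φ)) : ℂ) * Φ φ) hs
  beta_reduce at hcv
  rw [hcv]
  refine integral_congr_ae (Filter.Eventually.of_forall fun φ => ?_)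
  beta_reduce
  rw [Complex.real_smul, ← mul_assoc, ← Complex.ofReal_mul, jac_mul_exp hn (hS φ)]

/-- **(3.6)** p. 266 [PDF 10], verbatim: *"We rescale our expressions from T_ε to the unit lattice T₁. The scalar field is multiplied
by ε^{−(d−2)/2}, and we have [F] = ∫𝒟u𝒟φ ρ₀(u, φ), (3.6) ρ₀(u, φ) = F exp[−Σ_{p∈T₁**} e₀⁻²(1 − Re u(p)) − ½⟨φ, −Δ_uφ⟩
− Σ_{x∈T₁} P₀(φ(x)) − Σ_{x∈T₁} ½δm²ε²|φ(x)|² − ℰ₀ − E₁]. (3.7) … The constant ℰ₀ includes the scaling factors,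
ℰ₀ = E₀ − (d−2)|T₁| log ε⁻¹. (3.10) Each factor φ in F acquires a factor ε^{−(d−2)/2}, but we use the same notation."* — PROVED for
the typed (3.1) `bracket` of the action (3.3) on `T_ε` (`w = ε^d`, `c = ε⁻¹`, `d = P.d`): the exponent of `ρ₀` is C1's action (1.1) with
`e₀ = e(ε)`, `λ₀ = λ(ε)`, mass term `(1 + 2δm²)ε²` and constant `ℰ₀ + E₁ + |T₁|ε^d/(64λ)` (§4 and `selfInt_rescale_eq_Pk`, with its sign
note on the `δm²` term), `ℰ₀ = calE0 E₀ d |T₁| ε`, and `F` is evaluated at `ε^{−(d−2)/2}φ`; the identity holds for EVERY `F` (both sides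
take the junk value together), by the change of variables `φ ↦ ε^{−(d−2)/2}φ` in `ℂ^{T₁}` (Jacobian `ε^{−(d−2)|T₁|}`, real dimension
`2|T₁|`, Mathlib `Measure.integral_comp_smul`); `𝒟u` = `fieldMeasure P j U1` is untouched. [cite: BalabanImbrieJaffe1988, (3.6) p.266] -/
theorem bracket_rescale {ε : ℝ} (hε : 0 < ε) (e lam dm2 E₀ E₁ : ℝ)
    (F : GaugeField P j U1 → HiggsField P j → ℂ) :
    bracket (actionU1 (ε ^ P.d) ε⁻¹ e lam dm2 E₀ E₁) F =
      ∫ U, (∫ φ : HiggsField P j,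
        (Real.exp (-(BIJ85Sect1Model.action (eEps e ε P.d) (lamEps lam ε P.d) ((1 + 2 * dm2) * ε ^ 2)
          (calE0 E₀ P.d (Fintype.card (Balaban1983to89.Site P j)) ε + E₁ +
            Fintype.card (Balaban1983to89.Site P j) * ε ^ P.d / (64 * lam)) (fieldEquiv.symm U) φ)) : ℂ) *
          F U (phiScale ε P.d • φ)) ∂(fieldMeasure P j U1) := by
  unfold bracket
  exact integral_congr_ae (Filter.Eventually.of_forall fun U => integral_rescale hε e lam dm2 E₀ E₁ U (F U))

end

end Literature.MathematicalPhysics.QuantumFieldTheory.BalabanImbrieJaffe1984to88.BIJ88Sect3Rescaling
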